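import Literature.NumberTheory.LFunctions.StarkNoQuadraticSubfieldGlue
import Mathlib.FieldTheory.Normal.Closure
import Mathlib.FieldTheory.Galois.Basic
import Mathlib.GroupTheory.Perm.Cycle.Type
import Mathlib.Data.ZMod.QuotientGroup
import HarnessLib

/-!
# The embedded `S₃`-closure of a non-Galois cubic field, with a discriminant bound

Topic `Summits/QuantumAdvantage/QuantumAdvantage/Theorems`, stub `stub_cubicClosure` of the line
`dedekind-s3-collision` for the crux `DegreeOnePrimesEscape` (stmt-QuantumAdvantage-11543).

For a cubic number field `K` that is not Galois over `ℚ`, the normal closure `N` of `K` inside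
`ℚ̄` is a Galois number field of degree `6` with non-abelian Galois group (`≅ S₃`); it contains an
embedded copy of `K` and a quadratic subfield (the fixed field of the subgroup of order `3`), and
`|d_N| ≤ |d_K| ^ [N:ℚ] = |d_K| ^ 6` because the embedded copies of `K` separate `Gal(N/ℚ)`
(`Literature.NumberTheory.LFunctions.NumberField.natAbs_discr_le_pow_of_separating`, from the
tree's `GaloisClosureDiscriminant`).

The abstract step `cubicClosure_of_inputs` works for any finite Galois `M/ℚ` with
`#Gal(M/ℚ) ≤ 6`, a separating family of embeddings `K → M` and one embedding `K → M`; the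
`ℚ`-algebra structure of `M` is realigned with the canonical `DivisionRing.toRatAlgebra` through
`Subsingleton (Algebra ℚ M)`, so that the conclusion is stated over the instances of the crux.
-/

noncomputable section

open scoped NumberField nonZeroDivisors
open Literature.NumberTheory.LFunctions Literature.NumberTheory.LFunctions.NumberField

namespace Summit.QuantumAdvantage.QuantumAdvantage.Theorems.DegreeOnePrimesEscape

/-- Transport of `Algebra.IsAlgebraic` along an equality of algebra structures. -/
private theorem isAlgebraic_of_algebra_eq {F L : Type*} [Field F] [Field L] {A : Algebra F L}
    (B : Algebra F L) (h : A = B) (hA : @Algebra.IsAlgebraic F L _ _ A) :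
    @Algebra.IsAlgebraic F L _ _ B := by
  subst h; exact hA

/-- The normal closure of a finite extension `K/F` of a perfect field inside a normal `L/F` is
Galois over `F`. -/
private theorem isGalois_normalClosure_of_perfectField (F K L : Type*) [Field F] [Field K]
    [Field L] [Algebra F K] [Algebra F L] [FiniteDimensional F K] [Normal F L] [PerfectField F] :
    IsGalois F (IntermediateField.normalClosure F K L) where

/-- **Abstract step.** Let `K` be a non-Galois cubic number field and `M/ℚ` a finite Galois
extension with `#Gal(M/ℚ) ≤ 6` in which the embedded copies of `K` separate the Galois group,
together with one embedding `f₀ : K → M`. Then `M` is a Galois number field of degree `6` with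
non-abelian group, containing a copy of `K` and a quadratic subfield, and `|d_M| ≤ |d_K| ^ 6`. -/
private theorem cubicClosure_of_inputs (K : Type) [Field K] [NumberField K]
    (h3 : Module.finrank ℚ K = 3) (hK : ¬ IsGalois ℚ K)
    (M : Type) [Field M] {alg : Algebra ℚ M} (hfin : FiniteDimensional ℚ M) (hG : IsGalois ℚ M)
    (hcard : Nat.card (M ≃ₐ[ℚ] M) ≤ 6)
    (hsep : ∀ s : M ≃ₐ[ℚ] M, s ≠ 1 → ∃ f : K →ₐ[ℚ] M, s ∉ f.fieldRange.fixingSubgroup)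
    (f₀ : K →ₐ[ℚ] M) :
    ∃ (N : Type) (_ : Field N) (_ : NumberField N), IsGalois ℚ N ∧ Module.finrank ℚ N = 6 ∧
      (∃ g h : N ≃ₐ[ℚ] N, g * h ≠ h * g) ∧
      (∃ K' : IntermediateField ℚ N, Nonempty (K ≃ₐ[ℚ] K')) ∧
      (∃ k : IntermediateField ℚ N, Module.finrank ℚ k = 2) ∧
      (NumberField.discr N).natAbs ≤ (NumberField.discr K).natAbs ^ 6 := by
  have hcz : CharZero M := charZero_of_injective_algebraMap (algebraMap ℚ M).injective
  obtain rfl : alg = DivisionRing.toRatAlgebra := Subsingleton.elim _ _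
  have hNF : NumberField M := @NumberField.mk M _ hcz hfin
  -- the degree: `#Gal(M/ℚ) = [M:ℚ]`, `3 ∣ [M:ℚ] ≤ 6`, and `[M:ℚ] ≠ 3` since `K` is not Galois
  have hGal : Nat.card (M ≃ₐ[ℚ] M) = Module.finrank ℚ M := IsGalois.card_aut_eq_finrank ℚ M
  have htower : 3 * Module.finrank f₀.fieldRange M = Module.finrank ℚ M :=
    h3 ▸ finrank_mul_finrank_fieldRange K M f₀
  have hpos : 0 < Module.finrank ℚ M := hGal ▸ Nat.card_pos
  have hle6 : Module.finrank ℚ M ≤ 6 := hGal ▸ hcard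
  have hne3 : Module.finrank ℚ M ≠ 3 := by
    intro hM3
    have hinj : Function.Injective f₀.toLinearMap := f₀.toRingHom.injective
    have hsurj : Function.Surjective f₀.toLinearMap :=
      (LinearMap.injective_iff_surjective_of_finrank_eq_finrank (h3.trans hM3.symm)).mp hinj
    exact hK (IsGalois.of_algEquiv (AlgEquiv.ofBijective f₀ ⟨hinj, hsurj⟩).symm)
  have h6 : Module.finrank ℚ M = 6 := by omega
  -- non-abelian: otherwise `Gal(M/f₀(K))` is normal, so `f₀(K) ≅ K` is Galois over `ℚ`
  have hnc : ∃ g h : M ≃ₐ[ℚ] M, g * h ≠ h * g := by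
    by_contra hcomm
    push Not at hcomm
    haveI : f₀.fieldRange.fixingSubgroup.Normal :=
      ⟨fun n hn g => by rwa [hcomm g n, mul_inv_cancel_right]⟩
    haveI := IsGalois.of_algEquiv
      (IntermediateField.equivOfEq (IsGalois.fixedField_fixingSubgroup f₀.fieldRange))
    exact hK (IsGalois.of_algEquiv f₀.equivFieldRange.symm)
  -- the quadratic subfield: the fixed field of a subgroup of order `3`
  have hk : ∃ k : IntermediateField ℚ M, Module.finrank ℚ k = 2 := by
    haveI : Fact (Nat.Prime 3) := ⟨Nat.prime_three⟩
    have hdvd : 3 ∣ Nat.card (M ≃ₐ[ℚ] M) := by rw [hGal, h6]; norm_num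
    obtain ⟨g, hg⟩ := exists_prime_orderOf_dvd_card' 3 hdvd
    refine ⟨IntermediateField.fixedField (Subgroup.zpowers g), ?_⟩
    have h1 : Module.finrank (IntermediateField.fixedField (Subgroup.zpowers g)) M = 3 := by
      rw [IntermediateField.finrank_fixedField_eq_card, Nat.card_zpowers, hg]
    have h2 := Module.finrank_mul_finrank ℚ (IntermediateField.fixedField (Subgroup.zpowers g)) M
    rw [h1, h6] at h2
    omega
  -- the discriminant bound
  have hdisc : (NumberField.discr M).natAbs ≤ (NumberField.discr K).natAbs ^ 6 :=
    h6 ▸ natAbs_discr_le_pow_of_separating K M hsep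
  exact ⟨M, inferInstance, hNF, hG, h6, hnc, ⟨f₀.fieldRange, ⟨f₀.equivFieldRange⟩⟩, hk, hdisc⟩

/-- **The embedded `S₃`-closure of a non-Galois cubic field** (`CubicClosureBound` with `A = 6`):
for every cubic number field `K` that is not Galois over `ℚ` there is a Galois number field `N`
of degree `6` with non-abelian Galois group, containing a subfield isomorphic to `K` and a
quadratic subfield, with `|d_N| ≤ |d_K| ^ 6`. Here `N` is the normal closure of `K` in `ℚ̄`:
`#Gal(N/ℚ) ≤ 3!` (`card_algEquiv_normalClosure_le_factorial`), the embedded copies of `K`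
separate `Gal(N/ℚ)` (`exists_not_mem_fixingSubgroup_fieldRange`), and the rest is
`cubicClosure_of_inputs`. -/
theorem stub_cubicClosure :
    ∃ A : ℕ, ∀ (K : Type) [Field K] [NumberField K], Module.finrank ℚ K = 3 → ¬ IsGalois ℚ K →
      ∃ (N : Type) (_ : Field N) (_ : NumberField N), IsGalois ℚ N ∧ Module.finrank ℚ N = 6 ∧
        (∃ g h : N ≃ₐ[ℚ] N, g * h ≠ h * g) ∧
        (∃ K' : IntermediateField ℚ N, Nonempty (K ≃ₐ[ℚ] K')) ∧
        (∃ k : IntermediateField ℚ N, Module.finrank ℚ k = 2) ∧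
        (NumberField.discr N).natAbs ≤ (NumberField.discr K).natAbs ^ A := by
  refine ⟨6, fun K _ _ h3 hK => ?_⟩
  -- `ℚ̄` is an algebraic closure of `ℚ` also for the canonical `ℚ`-algebra structure
  haveI : IsAlgClosure ℚ (AlgebraicClosure ℚ) :=
    ⟨inferInstance, isAlgebraic_of_algebra_eq _ (Subsingleton.elim _ _)
      (AlgebraicClosure.isAlgebraic ℚ)⟩
  have hcard := card_algEquiv_normalClosure_le_factorial ℚ K (AlgebraicClosure ℚ)
  rw [← Nat.card_eq_fintype_card, h3] at hcard
  exact cubicClosure_of_inputs K h3 hK (IntermediateField.normalClosure ℚ K (AlgebraicClosure ℚ))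
    (normalClosure.is_finiteDimensional ℚ K (AlgebraicClosure ℚ))
    (isGalois_normalClosure_of_perfectField ℚ K (AlgebraicClosure ℚ))
    (hcard.trans (by decide))
    (fun _ hs => exists_not_mem_fixingSubgroup_fieldRange ℚ K (AlgebraicClosure ℚ) hs)
    ((normalClosure.algHomEquiv ℚ K (AlgebraicClosure ℚ)).symm IsAlgClosed.lift)

end Summit.QuantumAdvantage.QuantumAdvantage.Theorems.DegreeOnePrimesEscape

end
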